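import Mathlib.MeasureTheory.Measure.Haar.InnerProductSpace
import Literature.Analysis.FluidPDE.TaoClassGlue
import Literature.Analysis.FluidPDE.IsometryInvariance
import HarnessLib

/-!
# Symmetries of Tao-class solutions: isometry conjugation and propagation of equivariance

Analysis/FluidPDE support file (symmetry step for the global regularity theorem of
Ladyzhenskaya and Ukhovskii–Yudovich for axisymmetric Navier–Stokes flows without swirl,
`Literature.Analysis.FluidPDE.axisymmetric_no_swirl_global_regularity`, `Axisymmetric.lean`;
Lemarié-Rieusset 2016, Thm. 10.4: "This solution will be axisymmetric with no swirl", p. 285).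

For a linear isometry `R` of `ℝ³` and a Tao-class solution `(u, p)` on `[0, T]` from `u₀`
(`IsTaoSolutionOn T ν u₀ u p`, `TaoClassGlue.lean`; Tao 2013, Thm. 5.4), the conjugate
`(t, x) ↦ R (u t (R⁻¹ x))`, `p t (R⁻¹ x)` is a Tao-class solution from `R ∘ u₀ ∘ R⁻¹`
(`IsTaoSolutionOn.conj_linearIsometryEquiv`: rotation covariance of the equations,
`IsClassicalNSSolutionOn.conj_linearIsometryEquiv` of `IsometryInvariance.lean`, Majda–Bertozzi
2002, Prop. 1.1 (iii); all `L²`-based bounds are invariant since `R` preserves norms of iterated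
derivatives and Lebesgue measure). Consequently, if the datum is `R`-equivariant,
`R (u₀ (R⁻¹ x)) = u₀ x`, then so is the solution at every time of the **closed** slab
(`IsTaoSolutionOn.conj_eq_of_datum`): by Prodi–Serrin uniqueness in the class
(`IsTaoSolutionOn.eq_of_isTaoSolutionOn`) on `[0, T)`, and at `t = T` by continuity of the
slices in time (`IsTaoSolutionOn.eq_on_Icc`). This is the uniqueness proof that "the solution to
the Navier–Stokes equation will remain axisymmetric" (Majda–Bertozzi 2002, §2.3.3,
(2.52)–(2.53); KNSS 2009, §1), in Tao's class, for an arbitrary isometry; with the rotations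
about the axis it propagates axisymmetry and with a meridian reflection it propagates the
absence of swirl (`AxisymmetricReflection.lean`, applied downstream).

## Main statements (all proved)

* `IsSmoothSpaceTimeOn.eq_of_eqOn_Ico`, `IsTaoSolutionOn.eq_on_Icc`: agreement on `[0, T)`
  extends to `[0, T]` for jointly smooth fields; uniqueness in Tao's class on the closed slab.
* `lintegral_conj_linearIsometryEquiv`, `eLpNorm_conj_linearIsometryEquiv`: invariance of
  `∫⁻` and `L^q` norms under `w ↦ R ∘ w ∘ R⁻¹`.
* `IsTaoSolutionOn.conj_linearIsometryEquiv`, `IsTaoSolutionOn.conj_eq_of_datum`.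

## Mathlib / tree search

Tree: `IsClassicalNSSolutionOn.conj_linearIsometryEquiv`, `timeDerivWithin_conj_linearIsometryEquiv`
(`IsometryInvariance`), `IsTaoSolutionOn.eq_of_isTaoSolutionOn` (`TaoClassGlue`), the decaying
classical version `IsClassicalNSSolutionOn.isAxisymmetric_of_data_holds`
(`AxisymmetricEulerProofs`, needs `HasUniformRapidDecayOn`, not available in Tao's class).
Mathlib: `LinearIsometryEquiv.measurePreserving`, `LinearIsometryEquiv.norm_iteratedFDeriv_comp_left`,
`…_comp_right`, `MeasurePreserving.lintegral_comp_emb`, `eLpNorm_comp_measurePreserving`,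
`tendsto_nhds_unique'`, `closure_Ico`.

## References

* A. J. Majda, A. L. Bertozzi, *Vorticity and Incompressible Flow*, CUP 2002, §1.2 Prop. 1.1
  (iii), §2.3.3 (2.52)–(2.53). [MajdaBertozziCUP2002]
* P. G. Lemarié-Rieusset, *The Navier–Stokes Problem in the 21st Century*, CRC Press 2016,
  Thm. 10.4, p. 285. [LemarieRieusset2016]
* T. Tao, Anal. PDE 6 (2013) = arXiv:1108.1165, Thm. 5.4.
-/

noncomputable section

open MeasureTheory Set Function Filter Topology
open scoped ENNReal NNReal ContDiff

namespace Literature.Analysis.FluidPDE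

/-! ### Agreement on `[0, T)` extends to `[0, T]` -/

section Endpoint

variable {X : Type*} [NormedAddCommGroup X] [NormedSpace ℝ X]
variable {F : Type*} [NormedAddCommGroup F] [NormedSpace ℝ F]

/-- Two fields jointly smooth on `[0, T] × X` (`0 < T`) which agree at all times of `[0, T)`
agree at all times of `[0, T]`: each time line `s ↦ wᵢ s x` is continuous within `[0, T]` at
`T`, and `T` is in the closure of `[0, T)`. [folklore] -/
theorem IsSmoothSpaceTimeOn.eq_of_eqOn_Ico {T : ℝ} {w₁ w₂ : ℝ → X → F} (hT : 0 < T)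
    (h₁ : IsSmoothSpaceTimeOn (Icc 0 T) w₁) (h₂ : IsSmoothSpaceTimeOn (Icc 0 T) w₂)
    (heq : ∀ t ∈ Ico 0 T, w₁ t = w₂ t) : ∀ t ∈ Icc 0 T, w₁ t = w₂ t := by
  intro t ht
  rcases lt_or_eq_of_le ht.2 with htT | rfl
  · exact heq t ⟨ht.1, htT⟩
  · funext x
    have hc : ∀ {w : ℝ → X → F}, IsSmoothSpaceTimeOn (Icc 0 t) w →
        Tendsto (fun s => w s x) (𝓝[Ico 0 t] t) (𝓝 (w t x)) := fun {w} hw =>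
      ((hw.differentiableWithinAt_time ht x).continuousWithinAt.mono Ico_subset_Icc_self).tendsto
    have hev : (fun s => w₁ s x) =ᶠ[𝓝[Ico 0 t] t] fun s => w₂ s x :=
      eventually_nhdsWithin_of_forall fun s hs => congrFun (heq s hs) x
    have hne : (𝓝[Ico 0 t] t).NeBot := by
      rw [← mem_closure_iff_nhdsWithin_neBot, closure_Ico hT.ne, ]
      exact right_mem_Icc.2 hT.le
    exact tendsto_nhds_unique' hne ((hc h₁).congr' hev) (hc h₂)

end Endpoint

/-! ### Invariance of `L²`-based quantities under conjugation by a linear isometry -/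

section Conj

variable {E : Type*} [NormedAddCommGroup E] [InnerProductSpace ℝ E] [FiniteDimensional ℝ E]
  [MeasurableSpace E] [BorelSpace E]
variable {F : Type*} [NormedAddCommGroup F]

/-- Change of variables by a linear isometry: `∫⁻ g (R x) dx = ∫⁻ g x dx` (Lebesgue measure is
invariant, `LinearIsometryEquiv.measurePreserving`). [folklore] -/
theorem lintegral_comp_linearIsometryEquiv (R : E ≃ₗᵢ[ℝ] E) (g : E → ℝ≥0∞) :
    ∫⁻ x, g (R x) = ∫⁻ x, g x :=
  R.measurePreserving.lintegral_comp_emb R.toHomeomorph.measurableEmbedding g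

/-- The `L^q` norm is invariant under `w ↦ R ∘ w ∘ R⁻¹` for a linear isometry `R`
(`‖R v‖ = ‖v‖` pointwise and change of variables). [folklore] -/
theorem eLpNorm_conj_linearIsometryEquiv (R : E ≃ₗᵢ[ℝ] E) {w : E → E}
    (hw : AEStronglyMeasurable w volume) (q : ℝ≥0∞) :
    eLpNorm (fun x => R (w (R.symm x))) q volume = eLpNorm w q volume := by
  have h1 : eLpNorm (fun x => R (w (R.symm x))) q volume = eLpNorm (w ∘ R.symm) q volume :=
    eLpNorm_congr_norm_ae (Eventually.of_forall fun x => by simp)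
  rw [h1, eLpNorm_comp_measurePreserving hw R.symm.measurePreserving]

/-- The `L²` Sobolev quantities `∫⁻ ‖Dⁿ ·‖ₑ²` are invariant under `w ↦ R ∘ w ∘ R⁻¹` for a
linear isometry `R` (`LinearIsometryEquiv.norm_iteratedFDeriv_comp_left/right` and change of
variables). [folklore] -/
theorem lintegral_iteratedFDeriv_conj_linearIsometryEquiv (R : E ≃ₗᵢ[ℝ] E) (w : E → E) (n : ℕ) :
    ∫⁻ x, ‖iteratedFDeriv ℝ n (fun y => R (w (R.symm y))) x‖ₑ ^ 2 =
      ∫⁻ x, ‖iteratedFDeriv ℝ n w x‖ₑ ^ 2 := by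
  have hpt : ∀ x, ‖iteratedFDeriv ℝ n (fun y => R (w (R.symm y))) x‖ =
      ‖iteratedFDeriv ℝ n w (R.symm x)‖ := fun x => by
    have e1 : (fun y => R (w (R.symm y))) = R ∘ (w ∘ R.symm) := rfl
    rw [e1, R.norm_iteratedFDeriv_comp_left, R.symm.norm_iteratedFDeriv_comp_right]
  calc ∫⁻ x, ‖iteratedFDeriv ℝ n (fun y => R (w (R.symm y))) x‖ₑ ^ 2
      = ∫⁻ x, ‖iteratedFDeriv ℝ n w (R.symm x)‖ₑ ^ 2 := lintegral_congr fun x => by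
        rw [← ofReal_norm, hpt x, ofReal_norm]
    _ = ∫⁻ x, ‖iteratedFDeriv ℝ n w x‖ₑ ^ 2 :=
        lintegral_comp_linearIsometryEquiv R.symm (fun x => ‖iteratedFDeriv ℝ n w x‖ₑ ^ 2)

/-- Scalar version: `∫⁻ ‖Dⁿ (g ∘ R⁻¹)‖ₑ² = ∫⁻ ‖Dⁿ g‖ₑ²` for a linear isometry `R`. [folklore] -/
theorem lintegral_iteratedFDeriv_comp_linearIsometryEquiv_symm (R : E ≃ₗᵢ[ℝ] E)
    {G : Type*} [NormedAddCommGroup G] [NormedSpace ℝ G] (g : E → G) (n : ℕ) :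
    ∫⁻ x, ‖iteratedFDeriv ℝ n (fun y => g (R.symm y)) x‖ₑ ^ 2 =
      ∫⁻ x, ‖iteratedFDeriv ℝ n g x‖ₑ ^ 2 := by
  have hpt : ∀ x, ‖iteratedFDeriv ℝ n (fun y => g (R.symm y)) x‖ =
      ‖iteratedFDeriv ℝ n g (R.symm x)‖ := fun x => by
    have e1 : (fun y => g (R.symm y)) = g ∘ R.symm := rfl
    rw [e1, R.symm.norm_iteratedFDeriv_comp_right]
  calc ∫⁻ x, ‖iteratedFDeriv ℝ n (fun y => g (R.symm y)) x‖ₑ ^ 2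
      = ∫⁻ x, ‖iteratedFDeriv ℝ n g (R.symm x)‖ₑ ^ 2 := lintegral_congr fun x => by
        rw [← ofReal_norm, hpt x, ofReal_norm]
    _ = ∫⁻ x, ‖iteratedFDeriv ℝ n g x‖ₑ ^ 2 :=
        lintegral_comp_linearIsometryEquiv R.symm (fun x => ‖iteratedFDeriv ℝ n g x‖ₑ ^ 2)

end Conj

/-! ### Tao's class is invariant under conjugation by linear isometries -/

namespace IsTaoSolutionOn

variable {T ν : ℝ} {u₀ : EuclideanSpace ℝ (Fin 3) → EuclideanSpace ℝ (Fin 3)}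
  {u : ℝ → EuclideanSpace ℝ (Fin 3) → EuclideanSpace ℝ (Fin 3)}
  {p : ℝ → EuclideanSpace ℝ (Fin 3) → ℝ}

/-- **Uniqueness in Tao's class on the closed slab.** Two Tao-class solutions on `[0, T]` from
the same datum coincide at every `t ∈ [0, T]` (`eq_of_isTaoSolutionOn`, Prodi–Serrin, on
`[0, T)`; at `t = T` by continuity of the slices in time,
`IsSmoothSpaceTimeOn.eq_of_eqOn_Ico`). [cite: RobinsonRodrigoSadowski2016, Thm. 8.19] -/
theorem eq_on_Icc {u₁ u₂ : ℝ → EuclideanSpace ℝ (Fin 3) → EuclideanSpace ℝ (Fin 3)}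
    {p₁ p₂ : ℝ → EuclideanSpace ℝ (Fin 3) → ℝ} (h₁ : IsTaoSolutionOn T ν u₀ u₁ p₁)
    (h₂ : IsTaoSolutionOn T ν u₀ u₂ p₂) (hν : 0 < ν) (hT : 0 < T) :
    ∀ t ∈ Icc 0 T, u₁ t = u₂ t := by
  refine IsSmoothSpaceTimeOn.eq_of_eqOn_Ico hT h₁.classical.smooth_velocity
    h₂.classical.smooth_velocity fun t ht => ?_
  have h := eq_of_isTaoSolutionOn h₁ h₂ hν hT hT t
  rw [min_self] at h
  exact h ht

/-- **Conjugation of a Tao-class solution by a linear isometry** `R` of `ℝ³`: if `(u, p)` is a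
Tao-class solution on `[0, T]` (`0 < T`) from `u₀`, then `(t, x) ↦ R (u t (R⁻¹ x))`,
`(t, x) ↦ p t (R⁻¹ x)` is a Tao-class solution on `[0, T]` from `x ↦ R (u₀ (R⁻¹ x))`. The
equations are covariant (`IsClassicalNSSolutionOn.conj_linearIsometryEquiv`, Majda–Bertozzi
2002, Prop. 1.1 (iii); the zero force is fixed), `∂ₜ` commutes with the conjugation
(`timeDerivWithin_conj_linearIsometryEquiv`), and all `L²` Sobolev bounds and the
`L²`-continuity in time are invariant (`lintegral_iteratedFDeriv_conj_linearIsometryEquiv`,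
`eLpNorm_conj_linearIsometryEquiv`). [cite: MajdaBertozziCUP2002, §1.2 Prop. 1.1 (iii)] -/
theorem conj_linearIsometryEquiv (R : EuclideanSpace ℝ (Fin 3) ≃ₗᵢ[ℝ] EuclideanSpace ℝ (Fin 3))
    (h : IsTaoSolutionOn T ν u₀ u p) (hT : 0 < T) :
    IsTaoSolutionOn T ν (fun x => R (u₀ (R.symm x))) (fun t x => R (u t (R.symm x)))
      (fun t x => p t (R.symm x)) := by
  have hS : UniqueDiffOn ℝ (Icc 0 T) := uniqueDiffOn_Icc hT
  have hcl : IsClassicalNSSolutionOn (Icc 0 T) ν 0 (fun t x => R (u t (R.symm x)))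
      (fun t x => p t (R.symm x)) :=
    (h.classical.conj_linearIsometryEquiv R hS).congr_force fun t _ x => by simp
  -- slices of the conjugate are continuous
  have hcont : ∀ t ∈ Icc 0 T, Continuous fun x => R (u t (R.symm x)) := fun t ht =>
    R.continuous.comp ((h.classical.contDiff_velocity ht).continuous.comp R.symm.continuous)
  refine ⟨hcl, ?_, ?_, ?_, ?_, ?_⟩
  · -- datum
    funext x
    simp [h.initial]
  · -- Sobolev bounds of the velocity
    intro n
    obtain ⟨C, hC⟩ := h.sobolev n
    refine ⟨C, fun t ht => ?_⟩
    rw [lintegral_iteratedFDeriv_conj_linearIsometryEquiv R (u t) n]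
    exact hC t ht
  · -- Sobolev bounds of the time derivative
    intro n
    obtain ⟨C, hC⟩ := h.sobolev_dt n
    refine ⟨C, fun t ht => ?_⟩
    have heq : timeDerivWithin (Icc 0 T) (fun s x => R (u s (R.symm x))) t =
        fun x => R (timeDerivWithin (Icc 0 T) u t (R.symm x)) :=
      funext fun x => timeDerivWithin_conj_linearIsometryEquiv R h.classical.smooth_velocity hS ht x
    rw [heq, lintegral_iteratedFDeriv_conj_linearIsometryEquiv R (timeDerivWithin (Icc 0 T) u t) n]
    exact hC t ht
  · -- Sobolev bounds of the pressure
    intro n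
    obtain ⟨C, hC⟩ := h.sobolev_p n
    refine ⟨C, fun t ht => ?_⟩
    rw [lintegral_iteratedFDeriv_comp_linearIsometryEquiv_symm R (p t) n]
    exact hC t ht
  · -- `L²`-continuity in time
    refine ⟨fun t ht => ⟨(hcont t ht).aestronglyMeasurable, ?_⟩, fun t₀ ht₀ => ?_⟩
    · rw [eLpNorm_conj_linearIsometryEquiv R (h.aestronglyMeasurable_slice ht) 2]
      exact (h.continuousL2.1 t ht).eLpNorm_lt_top
    · refine (h.continuousL2.2 t₀ ht₀).congr' ?_
      filter_upwards [self_mem_nhdsWithin] with t ht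
      have hsub : ((fun x => R (u t (R.symm x))) - fun x => R (u t₀ (R.symm x))) =
          fun x => R ((u t - u t₀) (R.symm x)) := by
        funext x
        simp
      rw [hsub, eLpNorm_conj_linearIsometryEquiv R
        ((h.aestronglyMeasurable_slice ht).sub (h.aestronglyMeasurable_slice ht₀)) 2]

/-- **Propagation of equivariance in Tao's class.** Let `(u, p)` be a Tao-class solution on
`[0, T]` (`0 < T`, `0 < ν`) from a datum which is equivariant under the linear isometry `R`,
`R (u₀ (R⁻¹ x)) = u₀ x`. Then `R (u t (R⁻¹ x)) = u t x` for every `t ∈ [0, T]`: the conjugate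
solution (`conj_linearIsometryEquiv`) is a Tao-class solution from the same datum, so it
coincides with `(u, p)` on the closed slab (`eq_on_Icc`, Prodi–Serrin uniqueness). This is the
uniqueness argument of Majda–Bertozzi 2002, §2.3.3, (2.52)–(2.53) ("the solution to the
Navier–Stokes equation will remain axisymmetric"), for an arbitrary isometry, in Tao's class. [cite: MajdaBertozziCUP2002, §2.3.3 (2.52)–(2.53)] -/
theorem conj_eq_of_datum (R : EuclideanSpace ℝ (Fin 3) ≃ₗᵢ[ℝ] EuclideanSpace ℝ (Fin 3))
    (h : IsTaoSolutionOn T ν u₀ u p) (hν : 0 < ν) (hT : 0 < T)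
    (hR : ∀ x, R (u₀ (R.symm x)) = u₀ x) :
    ∀ t ∈ Icc 0 T, ∀ x, R (u t (R.symm x)) = u t x := by
  have hconj := h.conj_linearIsometryEquiv R hT
  have hdat : (fun x => R (u₀ (R.symm x))) = u₀ := funext hR
  rw [hdat] at hconj
  intro t ht x
  exact congrFun (eq_on_Icc hconj h hν hT t ht) x

end IsTaoSolutionOn

end Literature.Analysis.FluidPDE

end
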